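import Literature.AlgebraicGeometry.GroupSchemes.TorsionLayerBlockIdempotents
import Literature.AlgebraicGeometry.AbelianSchemes.PDivisibleGroupOfAbelianScheme
import Literature.AlgebraicGeometry.AbelianSchemes.AbelianSchemeOverBase
import Literature.AlgebraicGeometry.AbelianSchemes.AbelianSchemeAffineBase
import Literature.AlgebraicGeometry.Motives.AbelianVarietyFrobeniusTwistVariety
import HarnessLib

/-!
# The pins of the block-Lagrangian Frobenius law: `A[q] ↪ A` and `A[F_q] ↪ A[q]` with their instance blocks, in one `obtain` each
# ([Görtz–Wedhorn] Prop. 27.188 (1), Def. 4.45 (2); [Tate 1997] §(3.7); [Mumford AV] §15)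

Topic `Literature/AlgebraicGeometry/Motives`; namespace `Literature.AlgebraicGeometry.Motives.AbelianVariety`.  THEOREMS ONLY (no definition, no
named fact, no instance, no notation, no `sorry`).  Cell `hodgecm-mathlib` (D-0151), FLOOR 0, P6 «MOD programme» (crux hLiu418 = stmt-HodgeConjecture-24832,
`--supports`, count-neutral): organ **(α′) «BLF PIN PACKAGE»** = MEMO-ED2 (F0P6b-plan (g3), f97a8abc) §1 (D-G), the last hand-assembly between ★ and
the call of the P6b junction `bigBlockFrobeniusLaw_of_heads` (letter (BLF) `BlockLagrangianFrobenius` of `Lines/F0_P6b_FrobeniusLagrangian`, body ★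
`CartierDualBlockReduction.blockReduction`): its FIRST binders
`(G) [GrpObj G] [IsCommMonObj G] [IsAffine G.left] [Module.Free k (Alg G)] [Module.Finite k (Alg G)] (j : G ⟶ A.X) [IsMonHom j] [IsClosedImmersion j.left]
(hG : ∀ T t, (∃ s, s ≫ j = t) ↔ t ≫ ((((p ^ r : ℕ) : ℤ) • 𝟙 A).hom.hom.hom) = 1)` and
`(Φ) [… same block …] (φ : Φ ⟶ G) [IsMonHom φ] [IsClosedImmersion φ.left] (hΦ : ∀ T t, (∃ s, s ≫ φ = t) ↔ (t ≫ j) ≫ (A.relFrobenius p r).hom.hom.hom = 1)`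
are PRODUCED here for any abelian variety `A` over a field, so the GEN heir ∕ (γ) dock opens the call with two `obtain`s and no instance bookkeeping;
the remaining binders come from ★ (α) `TorsionLayerBlockIdempotents` (`β`, `W`, `𝒢l`, `Φ𝒢`).  HC_CM is proved only modulo the printed citations until rung
0 closes; this file is generic and changes no count.

THE MATHEMATICS.  [GortzWedhorn2023] Prop. 27.188 (1): for an abelian scheme `A → S` and `N ≥ 1`, `A[N] = Ker [N]` is a finite locally free closed
subgroup scheme (★ `PDivisibleGroupOfAbelianScheme`: `torsion`, `isFinite_torsion_hom`, `isClosedImmersion_torsionι_left`, `torsionGrpObj`,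
`isCommMonObj_torsion`); over `S = Spec k` it is therefore affine with finite (free) affine algebra (★ `Alg.moduleFinite`), and `[N]_A = (𝟙 A)^N`
is the morphism `N • 𝟙 A` of abelian varieties (★ `hom_zsmul_id`), which gives the letter's reading `hG`.  [Tate1997FiniteFlatGroupSchemes] §(3.7),
[GortzWedhorn2020] Def. 4.45 (2): the part of `A[N]` killed by the homomorphism `j ≫ F^{(r)}_{A∕k}` to the (separated) Frobenius twist is a closed
subgroup scheme `Ker(j ≫ F) ↪ A[N]`, again finite commutative — ★ (α) `exists_interLayer` — with the letter's reading `hΦ` up to reassociation.  (When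
`N = p^r` over a perfect field this is ALL of `A[F_q]`, ★ (FK0) `exists_closedImmersion_ker_relFrobenius_ker_pow_zsmul_id`; the letter does not need that.)

* `exists_torsionPin` — `G := A[N] ↪ A` with the (BLF) instance block and `hG` in the letter's tokens (`N • 𝟙 A`), any `N ≠ 0`.
* `exists_frobeniusKernelPin` — for ANY pin `j : G ↪ A` with the instance block: `Φ := Ker(j ≫ F^{(r)}) ↪ G` with the block and `hΦ` in the letter's tokens.
* `exists_torsion_frobeniusKernel_pins` — both at once at `N := p ^ r` (the letter's `((p ^ r : ℕ) : ℤ) • 𝟙 A`).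

## References
* [GortzWedhorn2023] U. Görtz, T. Wedhorn, *Algebraic Geometry II* (2023), Prop. 27.188 (1).
* [GortzWedhorn2020] U. Görtz, T. Wedhorn, *Algebraic Geometry I* (2nd ed. 2020), Definition 4.45 (2) (p. 117).
* [Tate1997FiniteFlatGroupSchemes] J. Tate, *Finite flat group schemes*, in: Modular Forms and Fermat's Last Theorem (1997), §(3.7).
* [MumfordAV1970] D. Mumford, *Abelian Varieties* (1970), §15 (p. 146).
-/

set_option autoImplicit false

-- Mathlib's `Over`/`Scheme` APIs are stated across semireducible wrappers (as in the ★ `GroupSchemes/*` files).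
set_option backward.isDefEq.respectTransparency false

noncomputable section

universe u

open CategoryTheory CategoryTheory.Limits AlgebraicGeometry MonoidalCategory CartesianMonoidalCategory
open scoped MonObj

namespace Literature.AlgebraicGeometry.Motives.AbelianVariety

open Literature.AlgebraicGeometry.AbelianSchemes Literature.AlgebraicGeometry.GroupSchemes
  Literature.AlgebraicGeometry.GroupSchemes.GroupSchemeKernel Literature.AlgebraicGeometry.GroupSchemes.AffineGroupScheme
  Literature.AlgebraicGeometry.GroupSchemes.TorsionLayer

variable {k : Type u} [Field k] (A : AbelianVariety k)

/-- **THE TORSION PIN `A[N] ↪ A` AS (BLF) QUANTIFIES IT** (one `obtain`): for an abelian variety `A∕k` and `N ≠ 0` there is a `k`-group scheme `G` —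
commutative, affine, `Γ(G)` finite free over `k` — with a homomorphism `j : G → A`, a closed immersion, such that a `T`-point `t` of `A` factors
through `j` iff `t ≫ (N • 𝟙 A) = 1` (`G := A[N]` of ★ `PDivisibleGroupOfAbelianScheme` at the abelian scheme `A → Spec k`; `[N] = N • 𝟙 A` by ★
`hom_zsmul_id`). [cite: GortzWedhorn2023, Prop. 27.188 (1)] [cite: MumfordAV1970, §15 (p. 146)] -/
theorem exists_torsionPin {N : ℕ} (hN : N ≠ 0) :
    ∃ (G : SchemeOver k) (_ : GrpObj G) (_ : IsCommMonObj G) (_ : IsAffine G.left) (_ : Module.Free k (Alg G)) (_ : Module.Finite k (Alg G))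
      (j : G ⟶ A.X) (_ : IsMonHom j) (_ : IsClosedImmersion j.left),
      ∀ ⦃T : SchemeOver k⦄ (t : T ⟶ A.X), (∃ s : T ⟶ G, s ≫ j = t) ↔ t ≫ (((N : ℤ) • 𝟙 A).hom.hom.hom) = 1 := by
  let A' : AbelianSchemeOver (Spec (.of k)) := (AbelianScheme.ofAbelianVariety A).toOver
  haveI : IsCommMonObj A'.X := inferInstanceAs (IsCommMonObj A.X)
  letI := A'.torsionGrpObj N
  haveI : IsFinite (A'.torsion N).hom := A'.isFinite_torsion_hom hN
  haveI : IsAffine (A'.torsion N).left := isAffine_left_of_isAffineHom (A'.torsion N)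
  haveI : Module.Finite k (Alg (A'.torsion N)) := Alg.moduleFinite (A'.torsion N)
  have hmul : A'.mulN N = (((N : ℤ) • 𝟙 A).hom.hom.hom) := by
    rw [AbelianSchemeOver.mulN_def, AbelianVariety.hom_zsmul_id, zpow_natCast]
    rfl
  refine ⟨A'.torsion N, A'.torsionGrpObj N, A'.isCommMonObj_torsion N, inferInstance, inferInstance, inferInstance, A'.torsionι N,
    A'.isMonHom_torsionι N, A'.isClosedImmersion_torsionι_left N, fun T t => ?_⟩
  rw [← hmul]
  exact exists_comp_kerι_eq_iff (A'.mulN N) t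

/-- **THE FROBENIUS-KERNEL PIN INSIDE A LAYER, AS (BLF) QUANTIFIES IT** (one `obtain`): for any closed subgroup `j : G ↪ A` of an abelian variety over
a field of exponential characteristic `p` (with the instance block), there is `φ : Φ ↪ G` — `Φ` commutative, affine, `Γ(Φ)` finite free, `φ` a
homomorphism and a closed immersion — such that a `T`-point `t` of `G` factors through `φ` iff `(t ≫ j) ≫ F^{(r)}_{A∕k} = 1` (`Φ := Ker(j ≫ F^{(r)})`, ★ (α)
`exists_interLayer`; the Frobenius twist is separated). [cite: GortzWedhorn2020, Definition 4.45 (2) (p. 117)] [cite: Tate1997FiniteFlatGroupSchemes, §(3.7)] -/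
theorem exists_frobeniusKernelPin (p : ℕ) [ExpChar k p] (r : ℕ) (G : SchemeOver k) [GrpObj G] [IsCommMonObj G] [IsAffine G.left]
    [Module.Finite k (Alg G)] (j : G ⟶ A.X) [IsMonHom j] :
    ∃ (Φ : SchemeOver k) (_ : GrpObj Φ) (_ : IsCommMonObj Φ) (_ : IsAffine Φ.left) (_ : Module.Free k (Alg Φ)) (_ : Module.Finite k (Alg Φ))
      (φ : Φ ⟶ G) (_ : IsMonHom φ) (_ : IsClosedImmersion φ.left),
      ∀ ⦃T : SchemeOver k⦄ (t : T ⟶ G), (∃ s : T ⟶ Φ, s ≫ φ = t) ↔ (t ≫ j) ≫ (A.relFrobenius p r).hom.hom.hom = 1 := by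
  haveI : IsSeparated (A.frobeniusTwist p r).X.hom := inferInstance
  obtain ⟨Φ, i1, i2, i3, i4, i5, φ, i6, i7, h⟩ := exists_interLayer G (j ≫ (A.relFrobenius p r).hom.hom.hom)
  exact ⟨Φ, i1, i2, i3, i4, i5, φ, i6, i7, fun T t => by rw [h t, Category.assoc]⟩

/-- **BOTH PINS OF (BLF) AT `q = p^r`** (one `obtain`): `G := A[p^r] ↪ A` reading `t ≫ (((p ^ r : ℕ) : ℤ) • 𝟙 A) = 1`, and `Φ := A[F_q] ∩ G ↪ G` reading
`(t ≫ j) ≫ F^{(r)}_{A∕k} = 1`, each with the instance block `GrpObj ∕ IsCommMonObj ∕ IsAffine ∕ Module.Free ∕ Module.Finite ∕ IsMonHom ∕ IsClosedImmersion`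
the letter quantifies over — for every abelian variety over a field of exponential characteristic `p` (no perfectness needed).
[cite: GortzWedhorn2023, Prop. 27.188 (1)] [cite: GortzWedhorn2020, Definition 4.45 (2) (p. 117)] [cite: Tate1997FiniteFlatGroupSchemes, §(3.7)] -/
theorem exists_torsion_frobeniusKernel_pins (p : ℕ) [ExpChar k p] (hp : p ≠ 0) (r : ℕ) :
    ∃ (G : SchemeOver k) (_ : GrpObj G) (_ : IsCommMonObj G) (_ : IsAffine G.left) (_ : Module.Free k (Alg G)) (_ : Module.Finite k (Alg G))
      (j : G ⟶ A.X) (_ : IsMonHom j) (_ : IsClosedImmersion j.left)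
      (_ : ∀ ⦃T : SchemeOver k⦄ (t : T ⟶ A.X), (∃ s : T ⟶ G, s ≫ j = t) ↔ t ≫ ((((p ^ r : ℕ) : ℤ) • 𝟙 A).hom.hom.hom) = 1)
      (Φ : SchemeOver k) (_ : GrpObj Φ) (_ : IsCommMonObj Φ) (_ : IsAffine Φ.left) (_ : Module.Free k (Alg Φ)) (_ : Module.Finite k (Alg Φ))
      (φ : Φ ⟶ G) (_ : IsMonHom φ) (_ : IsClosedImmersion φ.left),
      ∀ ⦃T : SchemeOver k⦄ (t : T ⟶ G), (∃ s : T ⟶ Φ, s ≫ φ = t) ↔ (t ≫ j) ≫ (A.relFrobenius p r).hom.hom.hom = 1 := by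
  obtain ⟨G, i1, i2, i3, i4, i5, j, i6, i7, hG⟩ := A.exists_torsionPin (N := p ^ r) (pow_ne_zero r hp)
  obtain ⟨Φ, k1, k2, k3, k4, k5, φ, k6, k7, hΦ⟩ := A.exists_frobeniusKernelPin p r G j
  exact ⟨G, i1, i2, i3, i4, i5, j, i6, i7, hG, Φ, k1, k2, k3, k4, k5, φ, k6, k7, hΦ⟩

end Literature.AlgebraicGeometry.Motives.AbelianVariety

end
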